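import Mathlib
import Summits.ResolutionOfSingularities.ResolutionOfSingularities.Theorems.WeightedInvariantLocalWeightedDropTOT2ConflictBudgetDefs
import Summits.ResolutionOfSingularities.ResolutionOfSingularities.Theorems.WeightedInvariantLocalWeightedDropTOT2BranchValuation
import Summits.ResolutionOfSingularities.ResolutionOfSingularities.Theorems.WeightedInvariantLocalWeightedDropNCBranchPrimesSymbolic

/-!
# TOT2-LINE (P3) brick B6-basics: the CONFLICT BUDGET under the presentation context — finite index set, unfolded valuation, finite values,
# the budget as honest finite sums

Sub-problem `ResolutionOfSingularities`, ENGINE crux `stmt-ResolutionOfSingularities-8899` (`LocalWeightedDrop`), skeleton v35 (2e806da509994632),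
registered stub `stub_conflictBudget` (P3).  [OURS · L1 W4.3 · chain w43 · res-L1-w43-stub-2 g6 (owner of (P3)); def-free; the first lemmas every consumer
of `…TOT2ConflictBudgetDefs` (p564344) needs, as asked by the registrar (res-L1-w43-plan-1 2026-08-27T19:49:39Z: «state `branchVal_eq` + the finiteness
facts making each `∑ᶠ` a `Finset.sum` as the FIRST lemmas of B6 so no consumer ever meets a junk finsum»).  Inputs: stub-1's B1
`NCBranchPrimes.finite_primes_symb_of_presContext` (p563192) and B2 `…TOT2BranchValuation` (p563799).  Engine bookkeeping; nothing here is a statement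
of any manuscript; AI-produced, gate-checked, weaker than expert review.]

Under the context binder of the budget laws, `ctx d A N := ∃ b δ Θ, Admissible b δ ∧ 2 ≤ δ.o ∧ δ.c = d ∧ δ.PresBy d A N Θ` (over a perfect field):
* `topPrimes_finite`, `topPrimesNL_finite` — the index sets are finite (B1);
* `two_le_of_ctx`, `monicGerm_mem_of_mem_topPrimes`, `pderiv_monicGerm_mem_of_mem_topPrimes`, `ringKrullDim_eq_one_of_mem_topPrimes` — a top-locus prime is
  a one-dimensional prime containing the germ and its partials;
* `branchVal_eq_addVal` — on a top-locus prime `branchVal` IS the additive valuation of B2 (no junk); whence `branchVal_eq_top_iff_mem`,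
  `branchVal_mul`, `branchVal_eq_zero_iff`, `one_le_branchVal_iff`, `one_le_branchVal_X`, `branchVal_X_ne_top` (on `topPrimesNL`), `branchMult_ne_top`,
  `one_le_branchMult`;
* `conflictBudget_eq_sum` — the budget as `Finset` sums over `(topPrimesNL_finite …).toFinset`.
-/

set_option linter.dupNamespace false -- mandated namespace of this single-conjunct summit

noncomputable section

namespace Summit.ResolutionOfSingularities.ResolutionOfSingularities.Theorems

namespace TOT2Branch

open MvPowerSeries IsLocalRing Literature.AlgebraicGeometry.Resolution

variable {k : Type} [Field k]

/-! ## The index sets are finite -/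

section Ctx

variable {d : ℕ} {A : Fin d → MvPowerSeries (Fin 2) k} {N : Finset (Fin 2)}

/-- **The top-locus primes are finitely many** under the context (stub-1's B1, same spelling). -/
theorem topPrimes_finite (p : ℕ) [Fact p.Prime] [CharP k p] [PerfectRing k p] 
    (hctx : ∃ (b : MvPowerSeries (Fin (2 + 1)) k) (δ : TameFourTupleDrop.Decoration k 2) (Θ : Fin (2 + 1) → MvPowerSeries (Fin (2 + 1)) k),
      TameFourTupleDrop.Admissible b δ ∧ 2 ≤ δ.o ∧ δ.c = d ∧ δ.PresBy d A N Θ) :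
    (topPrimes d A).Finite := by
  rw [topPrimes_eq]
  exact NCBranchPrimes.finite_primes_symb_of_presContext p hctx

/-- The non-line top-locus primes are finitely many under the context. -/
theorem topPrimesNL_finite (p : ℕ) [Fact p.Prime] [CharP k p] [PerfectRing k p] 
    (hctx : ∃ (b : MvPowerSeries (Fin (2 + 1)) k) (δ : TameFourTupleDrop.Decoration k 2) (Θ : Fin (2 + 1) → MvPowerSeries (Fin (2 + 1)) k),
      TameFourTupleDrop.Admissible b δ ∧ 2 ≤ δ.o ∧ δ.c = d ∧ δ.PresBy d A N Θ) :
    (topPrimesNL d A).Finite :=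
  (topPrimes_finite p hctx).subset (topPrimesNL_subset d A)

end Ctx

/-! ## A top-locus prime is a one-dimensional prime containing the germ and its partials -/

section TopPrime

variable {d : ℕ} {A : Fin d → MvPowerSeries (Fin 2) k} {P : Ideal (MvPowerSeries (Fin 3) k)}

/-- A top-locus prime is prime. -/
theorem isPrime_of_mem_topPrimes (hP : P ∈ topPrimes d A) : P.IsPrime := hP.1

/-- A top-locus prime is not the maximal ideal. -/
theorem ne_maximalIdeal_of_mem_topPrimes (hP : P ∈ topPrimes d A) : P ≠ maximalIdeal (MvPowerSeries (Fin 3) k) := hP.2.1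

/-- A top-locus prime contains the monic germ (`d ≠ 0`). -/
theorem monicGerm_mem_of_mem_topPrimes (hd : d ≠ 0) (hP : P ∈ topPrimes d A) : NCPoly.monicGerm d A ∈ P := by
  obtain ⟨s, hs, hsb⟩ := hP.2.2
  exact NCBranchPrimes.mem_of_mul_mem_pow hP.1 hd hs hsb

/-- A top-locus prime contains the partial derivatives of the monic germ (`d ≥ 2`). -/
theorem pderiv_monicGerm_mem_of_mem_topPrimes (hd : 2 ≤ d) (hP : P ∈ topPrimes d A) (i : Fin 3) :
    MvPowerSeries.pderiv i (NCPoly.monicGerm d A) ∈ P := by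
  obtain ⟨s, hs, hsb⟩ := hP.2.2
  exact NCBranchPrimes.pderiv_mem_of_mul_mem_pow hP.1 hd hs hsb i

/-- **A top-locus prime has a one-dimensional branch ring** (squarefree germ, `d ≥ 2`, perfect ground field). -/
theorem ringKrullDim_eq_one_of_mem_topPrimes (p : ℕ) [Fact p.Prime] [CharP k p] [PerfectRing k p] (hd : 2 ≤ d)
    (hsq : Squarefree (NCPoly.monicGerm d A)) (hP : P ∈ topPrimes d A) :
    ringKrullDim (MvPowerSeries (Fin 3) k ⧸ P) = 1 := by
  haveI := hP.1
  exact ringKrullDim_quotient_eq_one_of_squarefree P p hsq (monicGerm_mem_of_mem_topPrimes (by omega) hP)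
    (pderiv_monicGerm_mem_of_mem_topPrimes hd hP) hP.2.1

/-- The normalisation of the branch ring of a top-locus prime is a discrete valuation ring. -/
theorem isDiscreteValuationRing_of_mem_topPrimes (p : ℕ) [Fact p.Prime] [CharP k p] [PerfectRing k p] (hd : 2 ≤ d)
    (hsq : Squarefree (NCPoly.monicGerm d A)) (hP : P ∈ topPrimes d A) :
    haveI := hP.1
    IsDiscreteValuationRing (integralClosure (MvPowerSeries (Fin 3) k ⧸ P) (FractionRing (MvPowerSeries (Fin 3) k ⧸ P))) := by
  haveI := hP.1
  exact isDiscreteValuationRing_integralClosure P (ringKrullDim_eq_one_of_mem_topPrimes p hd hsq hP)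

/-! ## `branchVal` on a top-locus prime is the additive valuation -/

/-- **`branchVal` UNFOLDED on a top-locus prime**: no junk — it is the additive valuation of the normalisation applied to the class. -/
theorem branchVal_eq_addVal (p : ℕ) [Fact p.Prime] [CharP k p] [PerfectRing k p] (hd : 2 ≤ d) (hsq : Squarefree (NCPoly.monicGerm d A))
    (hP : P ∈ topPrimes d A) (f : MvPowerSeries (Fin 3) k) :
    branchVal P f =
      haveI := hP.1
      haveI := isDiscreteValuationRing_of_mem_topPrimes p hd hsq hP
      IsDiscreteValuationRing.addVal (integralClosure (MvPowerSeries (Fin 3) k ⧸ P) (FractionRing (MvPowerSeries (Fin 3) k ⧸ P)))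
        (algebraMap (MvPowerSeries (Fin 3) k ⧸ P) _ (Ideal.Quotient.mk P f)) := by
  haveI := hP.1
  exact branchVal_eq (isDiscreteValuationRing_of_mem_topPrimes p hd hsq hP) f

/-- **`branchVal P f = ⊤ ↔ f ∈ P`** on a top-locus prime. -/
theorem branchVal_eq_top_iff_mem (p : ℕ) [Fact p.Prime] [CharP k p] [PerfectRing k p] (hd : 2 ≤ d) (hsq : Squarefree (NCPoly.monicGerm d A)) (hP : P ∈ topPrimes d A) (f : MvPowerSeries (Fin 3) k) :
    branchVal P f = ⊤ ↔ f ∈ P := by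
  haveI := hP.1
  rw [branchVal_eq_addVal p hd hsq hP]
  exact addVal_mk_eq_top_iff P (ringKrullDim_eq_one_of_mem_topPrimes p hd hsq hP) f

/-- **Additivity** of `branchVal` on a top-locus prime. -/
theorem branchVal_mul (p : ℕ) [Fact p.Prime] [CharP k p] [PerfectRing k p] (hd : 2 ≤ d) (hsq : Squarefree (NCPoly.monicGerm d A)) (hP : P ∈ topPrimes d A) (f g : MvPowerSeries (Fin 3) k) :
    branchVal P (f * g) = branchVal P f + branchVal P g := by
  haveI := hP.1
  rw [branchVal_eq_addVal p hd hsq hP, branchVal_eq_addVal p hd hsq hP, branchVal_eq_addVal p hd hsq hP]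
  exact addVal_mk_mul P (ringKrullDim_eq_one_of_mem_topPrimes p hd hsq hP) f g

/-- **Powers**: `branchVal P (f^n) = n • branchVal P f`. -/
theorem branchVal_pow (p : ℕ) [Fact p.Prime] [CharP k p] [PerfectRing k p] (hd : 2 ≤ d) (hsq : Squarefree (NCPoly.monicGerm d A)) (hP : P ∈ topPrimes d A) (f : MvPowerSeries (Fin 3) k) (n : ℕ) :
    branchVal P (f ^ n) = n • branchVal P f := by
  haveI := hP.1
  rw [branchVal_eq_addVal p hd hsq hP, branchVal_eq_addVal p hd hsq hP]
  exact addVal_mk_pow P (ringKrullDim_eq_one_of_mem_topPrimes p hd hsq hP) f n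

/-- **Ultrametric inequality** for `branchVal` on a top-locus prime. -/
theorem min_branchVal_le_add (p : ℕ) [Fact p.Prime] [CharP k p] [PerfectRing k p] (hd : 2 ≤ d) (hsq : Squarefree (NCPoly.monicGerm d A)) (hP : P ∈ topPrimes d A) (f g : MvPowerSeries (Fin 3) k) :
    min (branchVal P f) (branchVal P g) ≤ branchVal P (f + g) := by
  haveI := hP.1
  rw [branchVal_eq_addVal p hd hsq hP, branchVal_eq_addVal p hd hsq hP, branchVal_eq_addVal p hd hsq hP]
  exact min_addVal_mk_le_add P (ringKrullDim_eq_one_of_mem_topPrimes p hd hsq hP) f g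

/-- **`branchVal P f = 0 ↔ f` is a unit.** -/
theorem branchVal_eq_zero_iff (p : ℕ) [Fact p.Prime] [CharP k p] [PerfectRing k p] (hd : 2 ≤ d) (hsq : Squarefree (NCPoly.monicGerm d A)) (hP : P ∈ topPrimes d A) (f : MvPowerSeries (Fin 3) k) :
    branchVal P f = 0 ↔ IsUnit f := by
  haveI := hP.1
  rw [branchVal_eq_addVal p hd hsq hP]
  exact addVal_mk_eq_zero_iff P (ringKrullDim_eq_one_of_mem_topPrimes p hd hsq hP) f

/-- **`1 ≤ branchVal P f ↔ f ∈ 𝔪`.** -/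
theorem one_le_branchVal_iff (p : ℕ) [Fact p.Prime] [CharP k p] [PerfectRing k p] (hd : 2 ≤ d) (hsq : Squarefree (NCPoly.monicGerm d A)) (hP : P ∈ topPrimes d A) (f : MvPowerSeries (Fin 3) k) :
    1 ≤ branchVal P f ↔ f ∈ maximalIdeal (MvPowerSeries (Fin 3) k) := by
  haveI := hP.1
  rw [branchVal_eq_addVal p hd hsq hP]
  exact one_le_addVal_mk_iff P (ringKrullDim_eq_one_of_mem_topPrimes p hd hsq hP) f

/-- Non-zero constants have `branchVal = 0`. -/
theorem branchVal_C (p : ℕ) [Fact p.Prime] [CharP k p] [PerfectRing k p] (hd : 2 ≤ d) (hsq : Squarefree (NCPoly.monicGerm d A)) (hP : P ∈ topPrimes d A) {c : k} (hc : c ≠ 0) :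
    branchVal P (C c) = 0 := by
  haveI := hP.1
  rw [branchVal_eq_addVal p hd hsq hP]
  exact addVal_mk_C P (ringKrullDim_eq_one_of_mem_topPrimes p hd hsq hP) hc

/-- **The variables have `branchVal ≥ 1`.** -/
theorem one_le_branchVal_X (p : ℕ) [Fact p.Prime] [CharP k p] [PerfectRing k p] (hd : 2 ≤ d) (hsq : Squarefree (NCPoly.monicGerm d A)) (hP : P ∈ topPrimes d A) (i : Fin 3) :
    1 ≤ branchVal P (X i) :=
  (one_le_branchVal_iff p hd hsq hP (X i)).mpr (X_mem_maximalIdeal k (Fin 3) i)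

/-- **`branchVal P (X i) ≠ ⊤ ↔ X i ∉ P`.** -/
theorem branchVal_X_ne_top_iff (p : ℕ) [Fact p.Prime] [CharP k p] [PerfectRing k p] (hd : 2 ≤ d) (hsq : Squarefree (NCPoly.monicGerm d A)) (hP : P ∈ topPrimes d A) (i : Fin 3) :
    branchVal P (X i) ≠ ⊤ ↔ X i ∉ P := by
  rw [Ne, branchVal_eq_top_iff_mem p hd hsq hP]

/-- On a non-line top-locus prime the value of `u₁` is finite. -/
theorem branchVal_X_zero_ne_top (p : ℕ) [Fact p.Prime] [CharP k p] [PerfectRing k p] (hd : 2 ≤ d) (hsq : Squarefree (NCPoly.monicGerm d A)) (hP : P ∈ topPrimesNL d A) : branchVal P (X 0) ≠ ⊤ :=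
  (branchVal_X_ne_top_iff p hd hsq hP.1 0).mpr hP.2.1

/-- On a non-line top-locus prime the value of `u₂` is finite. -/
theorem branchVal_X_one_ne_top (p : ℕ) [Fact p.Prime] [CharP k p] [PerfectRing k p] (hd : 2 ≤ d) (hsq : Squarefree (NCPoly.monicGerm d A)) (hP : P ∈ topPrimesNL d A) : branchVal P (X 1) ≠ ⊤ :=
  (branchVal_X_ne_top_iff p hd hsq hP.1 1).mpr hP.2.2

/-- On a non-line top-locus prime the multiplicity is finite. -/
theorem branchMult_ne_top (p : ℕ) [Fact p.Prime] [CharP k p] [PerfectRing k p] (hd : 2 ≤ d) (hsq : Squarefree (NCPoly.monicGerm d A)) (hP : P ∈ topPrimesNL d A) : branchMult P ≠ ⊤ := by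
  rw [branchMult]
  exact fun h => branchVal_X_zero_ne_top p hd hsq hP (min_eq_top.mp h).1

/-- The multiplicity is at least `1`. -/
theorem one_le_branchMult (p : ℕ) [Fact p.Prime] [CharP k p] [PerfectRing k p] (hd : 2 ≤ d) (hsq : Squarefree (NCPoly.monicGerm d A)) (hP : P ∈ topPrimes d A) : 1 ≤ branchMult P :=
  le_min (one_le_branchVal_X p hd hsq hP 0) (one_le_branchVal_X p hd hsq hP 1)

/-- The multiplicity is at most the value of `u₁`. -/
theorem branchMult_le_branchVal_X_zero (P : Ideal (MvPowerSeries (Fin 3) k)) : branchMult P ≤ branchVal P (X 0) := min_le_left _ _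

/-- The multiplicity is at most the value of `u₂`. -/
theorem branchMult_le_branchVal_X_one (P : Ideal (MvPowerSeries (Fin 3) k)) : branchMult P ≤ branchVal P (X 1) := min_le_right _ _

/-- The values read in `ℕ`: `1 ≤ (branchVal P (X 0)).toNat` on a non-line top-locus prime. -/
theorem one_le_toNat_branchVal_X_zero (p : ℕ) [Fact p.Prime] [CharP k p] [PerfectRing k p] (hd : 2 ≤ d) (hsq : Squarefree (NCPoly.monicGerm d A)) (hP : P ∈ topPrimesNL d A) :
    1 ≤ (branchVal P (X 0)).toNat := by
  have h1 := one_le_branchVal_X p hd hsq hP.1 0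
  have h2 := branchVal_X_zero_ne_top p hd hsq hP
  obtain ⟨n, hn⟩ := ENat.ne_top_iff_exists.mp h2
  rw [← hn] at h1 ⊢
  rw [ENat.toNat_coe]
  exact_mod_cast h1

/-- **Every non-line branch costs at least `2`.** -/
theorem two_le_charge (p : ℕ) [Fact p.Prime] [CharP k p] [PerfectRing k p] (hd : 2 ≤ d) (hsq : Squarefree (NCPoly.monicGerm d A)) (hP : P ∈ topPrimesNL d A) (N : Finset (Fin 2)) :
    2 ≤ charge d A N P := by
  rw [charge_eq]
  have := one_le_toNat_branchVal_X_zero p hd hsq hP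
  omega

end TopPrime

/-! ## The budget as finite sums -/

/-- **THE CONFLICT BUDGET AS `Finset` SUMS** over any finite enumeration of the non-line top-locus primes. -/
theorem conflictBudget_eq_sum {d : ℕ} {A : Fin d → MvPowerSeries (Fin 2) k} (hfin : (topPrimesNL d A).Finite) (N : Finset (Fin 2)) :
    conflictBudget d A N =
      (∑ P ∈ hfin.toFinset, charge d A N P) + 2 * ∑ P ∈ hfin.toFinset, ∑ P' ∈ hfin.toFinset.erase P, (pairVal P P').toNat := by
  rw [conflictBudget_eq, finsum_mem_eq_finite_toFinset_sum _ hfin, finsum_mem_eq_finite_toFinset_sum _ hfin]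
  congr 2
  refine Finset.sum_congr rfl fun P _ => ?_
  have hfin' : (topPrimesNL d A \ {P}).Finite := hfin.subset Set.sdiff_subset
  rw [finsum_mem_eq_finite_toFinset_sum _ hfin']
  refine Finset.sum_congr ?_ fun _ _ => rfl
  ext Q
  simp [Set.Finite.mem_toFinset, Finset.mem_erase, and_comm]

/-- Under the context: the budget as `Finset` sums over `(topPrimesNL_finite p hctx).toFinset`. -/
theorem conflictBudget_eq_sum_of_ctx (p : ℕ) [Fact p.Prime] [CharP k p] [PerfectRing k p] {d : ℕ} {A : Fin d → MvPowerSeries (Fin 2) k}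
    {N : Finset (Fin 2)}
    (hctx : ∃ (b : MvPowerSeries (Fin (2 + 1)) k) (δ : TameFourTupleDrop.Decoration k 2) (Θ : Fin (2 + 1) → MvPowerSeries (Fin (2 + 1)) k),
      TameFourTupleDrop.Admissible b δ ∧ 2 ≤ δ.o ∧ δ.c = d ∧ δ.PresBy d A N Θ) (N' : Finset (Fin 2)) :
    conflictBudget d A N' =
      (∑ P ∈ (topPrimesNL_finite p hctx).toFinset, charge d A N' P) +
        2 * ∑ P ∈ (topPrimesNL_finite p hctx).toFinset, ∑ P' ∈ (topPrimesNL_finite p hctx).toFinset.erase P, (pairVal P P').toNat :=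
  conflictBudget_eq_sum (topPrimesNL_finite p hctx) N'

end TOT2Branch

end Summit.ResolutionOfSingularities.ResolutionOfSingularities.Theorems

end
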